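import Literature.NumberTheory.EllipticCurves.ModularCurveManinSemistablePrimewiseProofs
import HarnessLib

/-!
# The Manin constant of a semistable optimal curve is `±1`: the fact decomposed into its three
# prime-by-prime sources (Mazur, Abbes–Ullmo, Česnavičius)

Topic `NumberTheory/EllipticCurves`; namespace `Literature.NumberTheory.EllipticCurves.ModularForms`.
Fact-decomposition file (librarian 2026-08-16) for the named fact
`Literature.NumberTheory.EllipticCurves.ModularForms.ModularParametrizationData.abs_maninConstant_eq_one_of_isSemistable`
(`ModularCurve.lean`: for a globally minimal model `W/ℚ` of a semistable elliptic curve and a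
modular parametrisation datum `D` of minimal degree among all data with the same newform, the
Manin constant satisfies `|c| = 1`; K. Česnavičius, *The Manin constant in the semistable case*,
Compositio Math. 154 (2018), Thm. 1.2).

State of the tree. The series `ModularCurveManinSemistable{Proofs, KernelProofs, BridgeProofs,
PrimewiseProofs, LatticeFormProofs, CoprimeFormProofs, LieGameProofs}` proves the fact EQUIVALENT
(`forall_abs_maninConstant_eq_one_of_isSemistable_iff_primewise`) to the prime-by-prime statement
in lattice form — for every globally minimal `W'/ℚ`, every datum `D'` with `c Λ_f = Λ_{E'}` (i.e.
`φ_{D'}` is the optimal parametrisation read against a Néron differential; such `W'` are exactly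
the models of the `X₀(N)`-optimal curve) of a semistable curve and every prime `p`, `p ∤ c` — and
derives the fact from the printed Thm. 1.2 (`abs_maninConstant_eq_one_of_isSemistable_of_primewise`:
"for a new elliptic optimal quotient `π : J₀(n) ↠ E` and a prime `p` with `ord_p(n) ≤ 1`,
`ord_p(c_π) = 0`"). The printed theorem itself is the union of three results, two of them prior
art which Česnavičius's paper quotes (and reproves) and one new — Compositio Math. 154 (2018) =
arXiv:1703.02951, Thm. 1.2, the case `p = 2 ∥ n` (the labels (MK-1), (MK-2) below are those of the
summary Thm. 1.4 (manin-known) in §1 of the COMPANION paper arXiv:1604.02165, *The Manin–Stevens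
constant in the semistable case*, whose §1 also has "existing techniques suffice if `p` is odd, so the
key new case is `p = 2`"; the Compositio paper's §1 refers to that summary as [Ces16f] Thm. 1.4):

* **Mazur 1978, Cor. 4.1** (MK-1): `p` odd, `ord_p(n) ≤ 1` ⟹ `ord_p(c_π) = 0`;
* **Abbes–Ullmo 1996, Thm. A** (MK-2): `p ∤ n` ⟹ `ord_p(c_π) = 0` (new at `p = 2`);
* **Česnavičius 2018, Thm. 1.2, the case `p = 2`, `ord_2(n) = 1`** — the new content.

This file NAMES the three pieces as children (the explicit exception of 2026-08-16 to D-0027 A7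
for budget-capped facts), each in the lattice language of `…PrimewiseProofs` (hypothesis `h12`
there), and PROVES the assembly:

* `mazur_not_dvd_maninConstant_of_odd`, `abbesUllmo_not_dvd_maninConstant_of_not_dvd_level`,
  `cesnavicius_not_two_dvd_maninConstant_of_two_dvd_level` — named facts (statements only);
* `ModularParametrizationData.abs_maninConstant_eq_one_of_isSemistable_holds_of` — the fact from
  the three children: case split on `p = 2` / `2 ∣ N'` inside `h12`, then
  `abs_maninConstant_eq_one_of_isSemistable_of_primewise` (semistable ⟹ level squarefree ⟹
  `p² ∤ N'` at every `p`; a datum of minimal degree is optimal).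

None of the three children restates the parent: each constrains one range of primes, for optimal
data at ANY level (not only squarefree ones). Their proofs (Néron models of `J₀(n)` and `E` over
`ℤ_(p)`, the Deligne–Rapoport model of `X₀(n)`, Raynaud's results on finite flat group schemes for
`e < p - 1`, Grothendieck duality and, at `p = 2`, Česnavičius's comparison of integral `p`-adic
étale and de Rham cohomology) need a theory of Néron models absent from Mathlib and the tree
(the seat's last blocker was `Literature.NumberTheory.EllipticCurves.exists_isNeronModel`).

## References

* B. Mazur, *Rational isogenies of prime degree*, Invent. Math. 44 (1978) 129–162, Cor. 4.1.
  [Mazur1978]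
* A. Abbes, E. Ullmo, *À propos de la conjecture de Manin pour les courbes elliptiques modulaires*,
  Compositio Math. 103 (1996) 269–286, Thm. A. [AbbesUllmo1996]
* K. Česnavičius, *The Manin constant in the semistable case*, Compositio Math. 154 (2018)
  1889–1920 = arXiv:1703.02951, Thm. 1.2 and §1 (held text `paper:arxiv-1703.02951` p0003 L20–25);
  the labels (MK-1), (MK-2) = Thm. 1.4 (manin-known) of §1 of the companion arXiv:1604.02165
  (`paper:arxiv-1604.02165` p0003 L51–L58), cited there as [Ces16f]. [Cesnavicius2018]
* A. Agashe, K. Ribet, W. A. Stein, *The Manin constant*, Pure Appl. Math. Q. 2 (2006) 617–636,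
  Thm. 2.6 (survey of MK-1, MK-2). [AgasheRibetStein2006]
* B. Edixhoven, *On the Manin constants of modular elliptic curves* (1991), Prop. 2 (`c ∈ ℤ`,
  built into the datum). [EdixhovenManin1991]

## Design notes

* "Optimal" is rendered, as in `…PrimewiseProofs`, by the lattice equality `Λ_{E'} ⊆ c Λ_f`
  (with the structure field `c Λ_f ⊆ Λ_{E'}`): then `ℂ/Λ_f ≅ ℂ/Λ_{E'}` by `z ↦ c z`, `W'` is a
  globally minimal model of the strong Weil curve `E_f` and `c` is its Manin constant
  (`…BridgeProofs`, `exists_optimalDatum'`). A twist of `E_f` inside a CM isogeny class never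
  satisfies it (its Néron lattice is a non-real multiple of `Λ_f`), so nothing beyond the printed
  statements is asserted.
* Abbes–Ullmo's Thm. A is stated for every prime `p ∤ N'` as printed; for odd `p` it overlaps
  with Mazur's Cor. 4.1, and the assembly uses it only at `p = 2`.
-/

noncomputable section

open scoped MatrixGroups ModularForm

open CongruenceSubgroup UpperHalfPlane

namespace Literature.NumberTheory.EllipticCurves.ModularForms

/-! ### The three prime-by-prime sources, in lattice form -/

/-- **Mazur 1978, Cor. 4.1 (the Manin constant at odd primes `p` with `p² ∤ N`).** For the
`X₀(N)`-optimal (strong Weil) curve `E` of conductor `N` with optimal parametrisation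
`π : J₀(N) ↠ E` and Manin constant `c_π` (relative to a Néron differential): if `p` is an odd prime
with `ord_p(N) ≤ 1`, then `ord_p(c_π) = 0` (quoted as (MK-1) in Česnavičius 2018, §1, and reproved
there). Lattice rendering (as the hypothesis `h12` of `ModularCurveManinSemistablePrimewiseProofs`):
for every globally minimal model `W'/ℚ` of an elliptic curve, every parametrisation datum `D'` at
level `N'` with `Λ_{E'} ⊆ c Λ_f` (hence `c Λ_f = Λ_{E'}`: `φ_{D'}` is the optimal parametrisation and
`c = D'.maninConstant ∈ ℤ` its Manin constant, Edixhoven 1991, Prop. 2) and every odd prime `p` with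
`p² ∤ N'`: `p ∤ c`. Named fact (statement only). [cite: Mazur1978, Cor. 4.1] -/
def mazur_not_dvd_maninConstant_of_odd : Prop :=
  ∀ (W' : WeierstrassCurve ℚ) [W'.IsElliptic] [W'.IsGloballyMinimal] {N' : ℕ} [NeZero N']
    (D' : ModularParametrizationData W' N'),
    (∀ z ∈ D'.L.lattice, ∃ w ∈ periodLattice D'.f, z = D'.c * w) →
    ∀ p : ℕ, p.Prime → p ≠ 2 → ¬ p ^ 2 ∣ N' → ¬ (p : ℤ) ∣ D'.maninConstant

/-- **Abbes–Ullmo 1996, Thm. A (the Manin constant at primes of good reduction).** For the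
`X₀(N)`-optimal curve `E` of conductor `N` with Manin constant `c`: if `p ∤ N` then `p ∤ c`
(quoted as (MK-2) in Česnavičius 2018, §1, for the case `p = 2`, `ord_2(N) = 0`, which is its
content beyond Mazur's Cor. 4.1; reproved there). Lattice rendering as in
`mazur_not_dvd_maninConstant_of_odd`: for every globally minimal `W'/ℚ`, every datum `D'` at level
`N'` with `Λ_{E'} ⊆ c Λ_f` and every prime `p ∤ N'`: `p ∤ c`. Named fact (statement only).
[cite: AbbesUllmo1996, Thm. A] -/
def abbesUllmo_not_dvd_maninConstant_of_not_dvd_level : Prop :=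
  ∀ (W' : WeierstrassCurve ℚ) [W'.IsElliptic] [W'.IsGloballyMinimal] {N' : ℕ} [NeZero N']
    (D' : ModularParametrizationData W' N'),
    (∀ z ∈ D'.L.lattice, ∃ w ∈ periodLattice D'.f, z = D'.c * w) →
    ∀ p : ℕ, p.Prime → ¬ p ∣ N' → ¬ (p : ℤ) ∣ D'.maninConstant

/-- **Česnavičius 2018, Thm. 1.2, the new case `p = 2`, `ord_2(N) = 1`.** For the `X₀(N)`-optimal
curve `E` of conductor `N` with Manin constant `c`: if `2 ∥ N` then `2 ∤ c` ("existing techniques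
suffice if `p` is odd, so the key new case is `p = 2`"; proved from the relation between the
modular degree and the congruence number measured on the cotangent space of the Néron model of
`J₀(N)`, and oldforms offsetting the two integral structures on weight-`2` cusp forms, op. cit.
§§2–5). Lattice rendering as in `mazur_not_dvd_maninConstant_of_odd`: for every globally minimal
`W'/ℚ`, every datum `D'` at level `N'` with `Λ_{E'} ⊆ c Λ_f`, if `2 ∣ N'` and `4 ∤ N'` then `2 ∤ c`.
Named fact (statement only). [cite: Cesnavicius2018, Thm. 1.2 (case p = 2, ord_2(n) = 1)] -/
def cesnavicius_not_two_dvd_maninConstant_of_two_dvd_level : Prop :=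
  ∀ (W' : WeierstrassCurve ℚ) [W'.IsElliptic] [W'.IsGloballyMinimal] {N' : ℕ} [NeZero N']
    (D' : ModularParametrizationData W' N'),
    (∀ z ∈ D'.L.lattice, ∃ w ∈ periodLattice D'.f, z = D'.c * w) →
    2 ∣ N' → ¬ 2 ^ 2 ∣ N' → ¬ (2 : ℤ) ∣ D'.maninConstant

/-! ### The assembly -/

namespace ModularParametrizationData

variable {W : WeierstrassCurve ℚ} {N : ℕ} [NeZero N] (D : ModularParametrizationData W N)

/-- **`abs_maninConstant_eq_one_of_isSemistable` from its three children.** Mazur's Cor. 4.1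
(`mazur_not_dvd_maninConstant_of_odd`: odd `p`, `p² ∤ N'`), Abbes–Ullmo's Thm. A
(`abbesUllmo_not_dvd_maninConstant_of_not_dvd_level`, used at `p = 2 ∤ N'`) and Česnavičius's new
case (`cesnavicius_not_two_dvd_maninConstant_of_two_dvd_level`: `2 ∥ N'`) together give the
printed prime-by-prime Thm. 1.2 — `p² ∤ N' ⟹ p ∤ c` for optimal data, the hypothesis `h12` of
`abs_maninConstant_eq_one_of_isSemistable_of_primewise` — whence the fact: for a semistable
curve the level is squarefree, so no prime divides `c`, and a datum of minimal degree is optimal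
(`ModularCurveManinSemistable{Primewise,Bridge}Proofs`).
[cite: Cesnavicius2018, Thm. 1.2 ("In particular, … holds when E is semistable")] -/
theorem abs_maninConstant_eq_one_of_isSemistable_holds_of
    (hM : mazur_not_dvd_maninConstant_of_odd)
    (hAU : abbesUllmo_not_dvd_maninConstant_of_not_dvd_level)
    (hC : cesnavicius_not_two_dvd_maninConstant_of_two_dvd_level) :
    D.abs_maninConstant_eq_one_of_isSemistable := by
  refine D.abs_maninConstant_eq_one_of_isSemistable_of_primewise ?_
  intro W' _ _ N' _ D' hlat p hp hp2
  by_cases h2 : p = 2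
  · subst h2
    by_cases hdvd : 2 ∣ N'
    · exact hC W' D' hlat hdvd hp2
    · exact hAU W' D' hlat 2 hp hdvd
  · exact hM W' D' hlat p hp h2 hp2

end ModularParametrizationData

/-! ### The printed Theorem 1.2 for `Γ₀(n)`, all primes at once (by-name handle)

Česnavičius, Compositio Math. 154 (2018) 1889–1920 = arXiv:1703.02951, Thm. 1.2, verbatim
(held text `paper:arxiv-1703.02951`, chunk p0003 L20–25): "For an `n ∈ ℤ_{≥1}`, a subgroup
`H ⊂ GL₂(Ẑ)` with `Γ₁(n) ⊂ H ⊂ Γ₀(n)`, a new elliptic optimal quotient `π : J_H ↠ E`, and a prime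
`p`, if `p² ∤ n`, then `ord_p(c_π) = 0` and `π` induces a smooth morphism on Néron models over
`ℤ_p`. In particular, [Manin's conjecture] holds in the case when `E` is semistable." The `Γ₀(n)`
case of the first conclusion is, prime by prime, the union of the three children above — Mazur
(odd `p`), Abbes–Ullmo (`p = 2 ∤ n`), Česnavičius (`p = 2 ∥ n`) — and is recorded here as ONE
theorem in their common lattice rendering (the hypothesis `h12` of
`ModularCurveManinSemistablePrimewiseProofs`), so that a consumer at a prime `p` with `p² ∤ N'` of
a curve whose conductor `N'` is NOT squarefree can cite the printed theorem by one name. The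
Néron-smoothness clause and the levels `H ≠ Γ₀(n)` are not transcribed. Locator note: the labels
(MK-1), (MK-2) quoted in the docstrings above are those of §1 of the companion paper
arXiv:1604.02165 (*The Manin–Stevens constant in the semistable case*); the Compositio paper is
arXiv:1703.02951. -/

/-- **Česnavičius 2018, Thm. 1.2 (the `Γ₀(n)` case, as printed: every prime `p` with `p² ∤ n`).**
For every globally minimal model `W'/ℚ` of an elliptic curve, every parametrisation datum `D'` at
level `N'` with `Λ_{E'} ⊆ c·Λ_f` (so `φ_{D'}` is the optimal parametrisation and
`c = D'.maninConstant ∈ ℤ` its Manin constant) and every prime `p` with `p² ∤ N'`: `p ∤ c` — from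
the three children `mazur_not_dvd_maninConstant_of_odd` (`p` odd),
`abbesUllmo_not_dvd_maninConstant_of_not_dvd_level` (`p = 2 ∤ N'`) and
`cesnavicius_not_two_dvd_maninConstant_of_two_dvd_level` (`2 ∥ N'`). This is exactly the
hypothesis `h12` of `abs_maninConstant_eq_one_of_isSemistable_of_primewise`; no squarefreeness of
`N'` is assumed. [cite: Cesnavicius2018, Thm. 1.2] [cite: Mazur1978, Cor. 4.1]
[cite: AbbesUllmo1996, Thm. A] -/
theorem cesnavicius2018_not_dvd_maninConstant_of_not_sq_dvd_level
    (hM : mazur_not_dvd_maninConstant_of_odd)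
    (hAU : abbesUllmo_not_dvd_maninConstant_of_not_dvd_level)
    (hC : cesnavicius_not_two_dvd_maninConstant_of_two_dvd_level)
    (W' : WeierstrassCurve ℚ) [W'.IsElliptic] [W'.IsGloballyMinimal] {N' : ℕ} [NeZero N']
    (D' : ModularParametrizationData W' N')
    (hopt : ∀ z ∈ D'.L.lattice, ∃ w ∈ periodLattice D'.f, z = D'.c * w)
    {p : ℕ} (hp : p.Prime) (hp2 : ¬ p ^ 2 ∣ N') : ¬ (p : ℤ) ∣ D'.maninConstant := by
  by_cases h2 : p = 2
  · subst h2
    by_cases hdvd : 2 ∣ N'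
    · exact hC W' D' hopt hdvd hp2
    · exact hAU W' D' hopt 2 hp hdvd
  · exact hM W' D' hopt p hp h2 hp2

/-- The same in valuation form (the binder shape `padicValInt p D.maninConstant = 0` used by
record-side consumers): under the three children, `ord_p(c) = 0` for every optimal datum `D'` of a
globally minimal `W'` at level `N'` and every prime `p` with `p² ∤ N'`.
[cite: Cesnavicius2018, Thm. 1.2] -/
theorem cesnavicius2018_padicValInt_maninConstant_eq_zero_of_not_sq_dvd_level
    (hM : mazur_not_dvd_maninConstant_of_odd)
    (hAU : abbesUllmo_not_dvd_maninConstant_of_not_dvd_level)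
    (hC : cesnavicius_not_two_dvd_maninConstant_of_two_dvd_level)
    (W' : WeierstrassCurve ℚ) [W'.IsElliptic] [W'.IsGloballyMinimal] {N' : ℕ} [NeZero N']
    (D' : ModularParametrizationData W' N')
    (hopt : ∀ z ∈ D'.L.lattice, ∃ w ∈ periodLattice D'.f, z = D'.c * w)
    (p : ℕ) [hp : Fact p.Prime] (hp2 : ¬ p ^ 2 ∣ N') : padicValInt p D'.maninConstant = 0 :=
  padicValInt.eq_zero_of_not_dvd
    (cesnavicius2018_not_dvd_maninConstant_of_not_sq_dvd_level hM hAU hC W' D' hopt hp.out hp2)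

/-- **The printed theorem IS the hypothesis `h12`.** Under the three children, the prime-by-prime
statement `h12` of `ModularParametrizationData.abs_maninConstant_eq_one_of_isSemistable_of_primewise`
holds for all data at all levels; composing with that theorem recovers
`abs_maninConstant_eq_one_of_isSemistable_holds_of`. [cite: Cesnavicius2018, Thm. 1.2] -/
theorem cesnavicius2018_primewise_of
    (hM : mazur_not_dvd_maninConstant_of_odd)
    (hAU : abbesUllmo_not_dvd_maninConstant_of_not_dvd_level)
    (hC : cesnavicius_not_two_dvd_maninConstant_of_two_dvd_level) :
    ∀ (W' : WeierstrassCurve ℚ) [W'.IsElliptic] [W'.IsGloballyMinimal] {N' : ℕ} [NeZero N']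
      (D' : ModularParametrizationData W' N'),
      (∀ z ∈ D'.L.lattice, ∃ w ∈ periodLattice D'.f, z = D'.c * w) →
      ∀ p : ℕ, p.Prime → ¬ p ^ 2 ∣ N' → ¬ (p : ℤ) ∣ D'.maninConstant :=
  fun W' _ _ _ _ D' hopt _ hp hp2 ↦
    cesnavicius2018_not_dvd_maninConstant_of_not_sq_dvd_level hM hAU hC W' D' hopt hp hp2

end Literature.NumberTheory.EllipticCurves.ModularForms

end
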